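import Mathlib
import Literature.NumberTheory.Sieve.PrimeGapLimitPoints
import Summits.Parity.GeneralizedHardyLittlewood.Theorems.PrimeGapTorusCapPart6
import HarnessLib

/-!
# Prime-gap limit points: the cap on the initial segment `[0, 7·inf U]` and the density of `𝓛` on `[0, 7c]` (cell parity-ideate, p4 ROUNDS 13–16, line L9) — part 1/4 (`fourPointFree_primeGap_compl` … `measure_five_le`)

Source: `HOME/parity-ideate-p4/round16/Sketch20.lean` (sha16 b835d559e74496fc, 4 997 lines, farm rc 0 / 0 warnings / 0 sorry /
axioms std-3; namespace `ParityIdeateP4R15`), §0–§3, cut by parity-ideate-p4 g19 (`ports/w7/build_w7.py`, pattern of lit g32's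
`ports/toruscap/build_toruscap.py`) to the dependency cone of the headline declarations `cap_first_period` (T ≤ 5m),
`cap_second_window` ([6m,7m]), `additiveLemma_holds` + `cap_first_gap` ([5m,6m]), `cap_le_seven`, `asymptoticCap4_le_seven`,
`fourPointFree_iff_triangleFree`, `fourPointFree_iff_delta4Free`, `primeGap_le_seven`, `primeGap_density_initial_segment`,
in a chain of 4 files of ≤ 400 lines (Theorems-side lint).  Statements byte-identical to the source EXCEPT (reuse, no
re-declaration): the vocabulary `BrauerFree`, `FourPointFree` and the lemma `brauerFree_of_fourPointFree` are the TREE's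
(`…Theorems.PrimeGapTorusCapPart1/Part6`, definitionally identical to the source's §0 `BrauerFree`/`FourPointFree`/
`FourPointFree.brauerFree`), the three dot-notation lemmas are renamed to flat names (`FourPointFree.delta4Free`/`.no_threeAP`/`.reflection` ↦ `fourPointFree_delta4Free`/`fourPointFree_no_threeAP`/`fourPointFree_reflection`) with their
five call sites rewritten, namespace `ParityIdeateP4R15` ↦ `Summit.Parity.GeneralizedHardyLittlewood.Theorems.PrimeGapInitialSegment`.
Non-Mathlib inputs: `Literature.NumberTheory.Sieve.PrimeGapLimitPoints` (`primeGapLimitSet`, `isClosed_primeGapLimitSet`, the NAMED fact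
`Merikoski2020_theorem1` = Merikoski 2020 Theorem 1, used HYPOTHESIS-STYLE, never asserted).  No `sorry`, no new axioms, no `instance`, no notation.
Cell-original mathematics (FRONTIER formalisation; record/instrument — nothing here bears on the parity problem): for a measurable
FOUR-POINT-FREE `U ⊆ (m,∞)` (no `x,y,z ∈ U` with `x+y, y+z, x+y+z ∈ U`) whose infimum `m ≥ 0` is approached from inside `U`,
`vol(U ∩ [0,T]) ≤ (T+m)/2` for every `T ≤ 7m` (one difference on `[0,5m]`; a reflection injection on `[6m,7m]`; one additive
lemma on the gap `[5m,6m]`); pay-off: given Merikoski's four-point theorem, with `c := sInf((0,∞) ∖ 𝓛)` the prime-gap limit-point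
set `𝓛` has `vol(𝓛 ∩ [0,T]) ≥ (T − c)/2` for all `0 ≤ T ≤ 7c` (print: `T/3`, [Merikoski2020GapLimitPoints, Cor. 2]).  The window
`(7m, 8m]` is OPEN (cell record: reduced to `HeavyBound`; pure cases proved; not in this port). HEADLINE DECLS IN THIS PART: `cap_first_period`, `fourPointFree_iff_triangleFree`, `fourPointFree_iff_delta4Free`.
-/

open Set MeasureTheory Filter
namespace Summit.Parity.GeneralizedHardyLittlewood.Theorems.PrimeGapInitialSegment
open Summit.Parity.GeneralizedHardyLittlewood.Theorems.PrimeGapTorusCap (BrauerFree FourPointFree brauerFree_of_fourPointFree)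
open Literature.NumberTheory.Sieve
/-! ## §0 The complement of `𝓛` is four-point-free and open (vocabulary `BrauerFree`/`FourPointFree`: the tree's, from `PrimeGapTorusCap`) -/

/-- The positive non-limit points of normalized prime gaps form a four-point-free open set
(Merikoski's Theorem 1 read on the complement). -/
theorem fourPointFree_primeGap_compl (h : Merikoski2020_theorem1) :
    FourPointFree (Ioi 0 \ primeGapLimitSet) := by
  intro x y z hx hy hz hxy hyz hxyz
  have hx0 : 0 < x := hx.1
  have hy0 : 0 < y := hy.1
  have hz0 : 0 < z := hz.1
  rcases h 0 x (x + y) (x + y + z) hx0.le (by linarith) (by linarith) with h' | h' | h' | h' | h' | h'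
  · exact hx.2 (by simpa using h')
  · exact hxy.2 (by simpa using h')
  · exact hxyz.2 (by simpa using h')
  · have e : x + y - x = y := by ring
    rw [e] at h'; exact hy.2 h'
  · have e : x + y + z - x = y + z := by ring
    rw [e] at h'; exact hyz.2 h'
  · have e : x + y + z - (x + y) = z := by ring
    rw [e] at h'; exact hz.2 h'

/-- (cell parity-ideate p4, Sketch20 — helper; statement verbatim) -/
theorem isOpen_primeGap_compl : IsOpen (Ioi (0:ℝ) \ primeGapLimitSet) :=
  isOpen_Ioi.sdiff isClosed_primeGapLimitSet

/-! ## §0b The first period (ROUND-13, copied verbatim so that this file states the whole known region) -/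

section FirstPeriod
variable {U : Set ℝ}
/-- Tiling lemma: `vol(U ∩ [a, a+3u]) ≤ 2u` for Brauer-free measurable `U`, `u ∈ U`, `u > 0`. -/
theorem volume_inter_Icc_three_windows_le (hUm : MeasurableSet U) (hB : BrauerFree U) {u : ℝ}
    (hu : 0 < u) (huU : u ∈ U) (a : ℝ) :
    volume (U ∩ Icc a (a + 3 * u)) ≤ ENNReal.ofReal (2 * u) := by
  have hm : ∀ c : ℝ, MeasurableSet ((fun t : ℝ => t + c) ⁻¹' U) := fun c =>
    hUm.preimage (measurable_id.add_const c)
  set I : Set ℝ := Icc a (a + u) with hI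
  set A : Set ℝ := U ∩ I with hA
  set A₁ : Set ℝ := (fun t : ℝ => t + u) ⁻¹' U ∩ I with hA₁
  set A₂ : Set ℝ := (fun t : ℝ => t + 2 * u) ⁻¹' U ∩ I with hA₂
  have hA₁m : MeasurableSet A₁ := (hm u).inter measurableSet_Icc
  have hA₂m : MeasurableSet A₂ := (hm (2 * u)).inter measurableSet_Icc
  have hIvol : volume I = ENNReal.ofReal u := by
    simp [hI, Real.volume_Icc]
  -- the shifted windows have the volumes of A₁, A₂
  have hw1 : volume (U ∩ Icc (a + u) (a + 2 * u)) = volume A₁ := by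
    have e : (fun t : ℝ => t + u) ⁻¹' (U ∩ Icc (a + u) (a + 2 * u)) = A₁ := by
      ext t
      simp only [hA₁, hI, mem_preimage, mem_inter_iff, mem_Icc]
      constructor
      · rintro ⟨h, h1, h2⟩; exact ⟨h, by linarith, by linarith⟩
      · rintro ⟨h, h1, h2⟩; exact ⟨h, by linarith, by linarith⟩
    rw [← e, measure_preimage_add_right]
  have hw2 : volume (U ∩ Icc (a + 2 * u) (a + 3 * u)) = volume A₂ := by
    have e : (fun t : ℝ => t + 2 * u) ⁻¹' (U ∩ Icc (a + 2 * u) (a + 3 * u)) = A₂ := by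
      ext t
      simp only [hA₂, hI, mem_preimage, mem_inter_iff, mem_Icc]
      constructor
      · rintro ⟨h, h1, h2⟩; exact ⟨h, by linarith, by linarith⟩
      · rintro ⟨h, h1, h2⟩; exact ⟨h, by linarith, by linarith⟩
    rw [← e, measure_preimage_add_right]
  -- A ∩ A₁ ∩ A₂ = ∅ by Brauer-freeness with d = u
  have hempty : A ∩ (A₁ ∩ A₂) = ∅ := by
    ext t
    constructor
    · rintro ⟨⟨htU, -⟩, ⟨h1U, -⟩, ⟨h2U, -⟩⟩
      exact (hB u t huU htU h1U h2U).elim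
    · intro h; exact h.elim
  have h3 : volume A + volume A₁ + volume A₂ ≤ volume I + volume I := by
    have e12 : volume A₁ + volume A₂ = volume (A₁ ∪ A₂) + volume (A₁ ∩ A₂) :=
      (measure_union_add_inter A₁ hA₂m).symm
    have e0 : volume A + volume (A₁ ∩ A₂) = volume (A ∪ (A₁ ∩ A₂)) + volume (A ∩ (A₁ ∩ A₂)) :=
      (measure_union_add_inter A (hA₁m.inter hA₂m)).symm
    rw [hempty, measure_empty, add_zero] at e0
    calc volume A + volume A₁ + volume A₂ = volume A + (volume A₁ + volume A₂) := by ring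
      _ = volume (A₁ ∪ A₂) + (volume A + volume (A₁ ∩ A₂)) := by rw [e12]; ring
      _ = volume (A₁ ∪ A₂) + volume (A ∪ (A₁ ∩ A₂)) := by rw [e0]
      _ ≤ volume I + volume I := by
          have sub1 : A₁ ∪ A₂ ⊆ I := union_subset (fun t ht => ht.2) (fun t ht => ht.2)
          have sub2 : A ∪ (A₁ ∩ A₂) ⊆ I := union_subset (fun t ht => ht.2) (fun t ht => ht.1.2)
          exact add_le_add (measure_mono sub1) (measure_mono sub2)
  -- cover [a, a+3u] by the three windows
  have hcov : U ∩ Icc a (a + 3 * u) ⊆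
      (A ∪ (U ∩ Icc (a + u) (a + 2 * u))) ∪ (U ∩ Icc (a + 2 * u) (a + 3 * u)) := by
    intro t ht
    obtain ⟨htU, hta, htb⟩ := ht
    by_cases h1 : t ≤ a + u
    · exact Or.inl (Or.inl ⟨htU, hta, h1⟩)
    · by_cases h2 : t ≤ a + 2 * u
      · push Not at h1
        exact Or.inl (Or.inr ⟨htU, h1.le, h2⟩)
      · push Not at h2
        exact Or.inr ⟨htU, h2.le, htb⟩
  calc volume (U ∩ Icc a (a + 3 * u))
      ≤ volume ((A ∪ (U ∩ Icc (a + u) (a + 2 * u))) ∪ (U ∩ Icc (a + 2 * u) (a + 3 * u))) :=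
        measure_mono hcov
    _ ≤ volume (A ∪ (U ∩ Icc (a + u) (a + 2 * u))) + volume (U ∩ Icc (a + 2 * u) (a + 3 * u)) :=
        measure_union_le _ _
    _ ≤ (volume A + volume (U ∩ Icc (a + u) (a + 2 * u))) +
          volume (U ∩ Icc (a + 2 * u) (a + 3 * u)) := by
        gcongr; exact measure_union_le _ _
    _ = volume A + volume A₁ + volume A₂ := by rw [hw1, hw2]
    _ ≤ volume I + volume I := h3
    _ = ENNReal.ofReal (2 * u) := by
        rw [hIvol, ← ENNReal.ofReal_add hu.le hu.le]; congr 1; ring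

/-- THE FIRST-PERIOD RUNG of `(A∞')`: if `m ≥ 0` is the infimum of the Brauer-free measurable set
`U ⊆ (m, ∞)` (approached from inside `U`), then `vol(U ∩ [0,T]) ≤ (T + m)/2` for every `T ≤ 5m`. -/
theorem cap_first_period (hUm : MeasurableSet U) (hB : BrauerFree U) {m : ℝ} (hm : 0 ≤ m)
    (hUgt : U ⊆ Ioi m) (hinf : ∀ ε > 0, ∃ u ∈ U, u < m + ε) {T : ℝ} (hT : T ≤ 5 * m) :
    volume (U ∩ Icc 0 T) ≤ ENNReal.ofReal ((T + m) / 2) := by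
  by_cases h3m : T ≤ 3 * m
  · -- trivial range: U ∩ [0,T] ⊆ (m, T]
    have hsub : U ∩ Icc 0 T ⊆ Ioc m T := fun t ht => ⟨hUgt ht.1, ht.2.2⟩
    calc volume (U ∩ Icc 0 T) ≤ volume (Ioc m T) := measure_mono hsub
      _ = ENNReal.ofReal (T - m) := Real.volume_Ioc
      _ ≤ ENNReal.ofReal ((T + m) / 2) := ENNReal.ofReal_le_ofReal (by linarith)
  · push Not at h3m
    have hmpos : 0 < m := by linarith
    have hc : 0 ≤ (T + m) / 2 := by linarith
    -- for every δ > 0: vol ≤ (T+m)/2 + δ, using some u ∈ U with u < m + δ/2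
    have key : ∀ δ : ℝ, 0 < δ → volume (U ∩ Icc 0 T) ≤ ENNReal.ofReal ((T + m) / 2 + δ) := by
      intro δ hδ
      obtain ⟨u, huU, hu⟩ := hinf (δ / 2) (by linarith)
      have hum : m < u := hUgt huU
      have hu0 : 0 < u := lt_of_le_of_lt hm hum
      have hcov : U ∩ Icc 0 T ⊆ (U ∩ Icc m (m + 3 * u)) ∪ Icc (m + 3 * u) T := by
        intro t ht
        have htm : m < t := hUgt ht.1
        by_cases h : t ≤ m + 3 * u
        · exact Or.inl ⟨ht.1, htm.le, h⟩
        · push Not at h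
          exact Or.inr ⟨h.le, ht.2.2⟩
      calc volume (U ∩ Icc 0 T)
          ≤ volume ((U ∩ Icc m (m + 3 * u)) ∪ Icc (m + 3 * u) T) := measure_mono hcov
        _ ≤ volume (U ∩ Icc m (m + 3 * u)) + volume (Icc (m + 3 * u) T) := measure_union_le _ _
        _ ≤ ENNReal.ofReal (2 * u) + ENNReal.ofReal (T - (m + 3 * u)) := by
            gcongr
            · exact volume_inter_Icc_three_windows_le hUm hB hu0 huU m
            · exact (Real.volume_Icc).le
        _ ≤ ENNReal.ofReal ((T + m) / 2 + δ) := by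
            by_cases hsplit : T - (m + 3 * u) ≤ 0
            · rw [ENNReal.ofReal_of_nonpos hsplit, add_zero]
              exact ENNReal.ofReal_le_ofReal (by linarith)
            · push Not at hsplit
              rw [← ENNReal.ofReal_add (by linarith) hsplit.le]
              exact ENNReal.ofReal_le_ofReal (by linarith)
    refine ENNReal.le_of_forall_pos_le_add fun ε hε _ => ?_
    calc volume (U ∩ Icc 0 T) ≤ ENNReal.ofReal ((T + m) / 2 + ε) := key ε (by exact_mod_cast hε)
      _ = ENNReal.ofReal ((T + m) / 2) + ε := by
          rw [ENNReal.ofReal_add hc ε.coe_nonneg, ENNReal.ofReal_coe_nnreal]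

end FirstPeriod
/-! ## §1 Structure of four-point-free sets -/

section Structure
variable {U : Set ℝ}
/-- `Cay(ℝ, ±U)[U]` is triangle-free: no `a < b < c` in `U` with all three differences in `U`. -/
def TriangleFree (U : Set ℝ) : Prop :=
  ∀ a b c : ℝ, a ∈ U → b ∈ U → c ∈ U → b - a ∈ U → c - b ∈ U → c - a ∈ U → False

/-- Four-point-free ⟺ triangle-free (`(a, b, c) = (x, x + y, x + y + z)`). -/
theorem fourPointFree_iff_triangleFree : FourPointFree U ↔ TriangleFree U := by
  constructor
  · intro h a b c ha hb hc hba hcb hca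
    refine h a (b - a) (c - b) ha hba hcb ?_ ?_ ?_
    · have e : a + (b - a) = b := by ring
      rwa [e]
    · have e : b - a + (c - b) = c - a := by ring
      rwa [e]
    · have e : a + (b - a) + (c - b) = c := by ring
      rwa [e]
  · intro h x y z hx hy hz hxy hyz hxyz
    refine h x (x + y) (x + y + z) hx hxy hxyz ?_ ?_ ?_
    · have e : x + y - x = y := by ring
      rwa [e]
    · have e : x + y + z - (x + y) = z := by ring
      rwa [e]
    · have e : x + y + z - x = y + z := by ring
      rwa [e]

/-- `U` meets no difference set of four reals `β₀ < β₁ < β₂ < β₃` (the `Δ₄`-FREE reading; its negation on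
the complement is the four-point property). -/
def Delta4Free (U : Set ℝ) : Prop :=
  ∀ β₀ β₁ β₂ β₃ : ℝ, β₀ < β₁ → β₁ < β₂ → β₂ < β₃ →
    ¬ (β₁ - β₀ ∈ U ∧ β₂ - β₀ ∈ U ∧ β₃ - β₀ ∈ U ∧ β₂ - β₁ ∈ U ∧ β₃ - β₁ ∈ U ∧ β₃ - β₂ ∈ U)

/-- (cell parity-ideate p4, Sketch20 — helper; statement verbatim) -/
theorem fourPointFree_delta4Free (h : FourPointFree U) : Delta4Free U := by
  intro β₀ β₁ β₂ β₃ _ _ _ hmem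
  obtain ⟨h10, h20, h30, h21, h31, h32⟩ := hmem
  refine h (β₁ - β₀) (β₂ - β₁) (β₃ - β₂) h10 h21 h32 ?_ ?_ ?_
  · have e : β₁ - β₀ + (β₂ - β₁) = β₂ - β₀ := by ring
    rwa [e]
  · have e : β₂ - β₁ + (β₃ - β₂) = β₃ - β₁ := by ring
    rwa [e]
  · have e : β₁ - β₀ + (β₂ - β₁) + (β₃ - β₂) = β₃ - β₀ := by ring
    rwa [e]

/-- For `U ⊆ (0,∞)` the two readings coincide. -/
theorem fourPointFree_iff_delta4Free (hU : U ⊆ Ioi 0) : FourPointFree U ↔ Delta4Free U := by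
  refine ⟨fourPointFree_delta4Free, fun h x y z hx hy hz hxy hyz hxyz => ?_⟩
  have hx0 : 0 < x := hU hx
  have hy0 : 0 < y := hU hy
  have hz0 : 0 < z := hU hz
  refine h 0 x (x + y) (x + y + z) hx0 (by linarith) (by linarith) ⟨?_, ?_, ?_, ?_, ?_, ?_⟩
  · simpa using hx
  · simpa using hxy
  · simpa using hxyz
  · have e : x + y - x = y := by ring
    rwa [e]
  · have e : x + y + z - x = y + z := by ring
    rwa [e]
  · have e : x + y + z - (x + y) = z := by ring
    rwa [e]

/-- No three-term progression with step in `U` (Brauer). -/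
theorem fourPointFree_no_threeAP (h : FourPointFree U) {u y : ℝ} (hu : u ∈ U) (hy : y ∈ U)
    (h1 : y + u ∈ U) (h2 : y + 2 * u ∈ U) : False :=
  brauerFree_of_fourPointFree h u y hu hy h1 h2

/-- **THE REFLECTION TRIANGLE.** If `u ∈ U`, the line `t'` carries position `2` and the line `t` carries
positions `4, 5`, then the reflected line `s = t + u − t'` cannot carry positions `1, 2`:
`{t' + 2u, t + 4u, t + 5u}` would be a triangle with differences `2u − δ, 3u − δ, u`. -/
theorem fourPointFree_reflection (h : FourPointFree U) {u t t' : ℝ} (hu : u ∈ U)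
    (h2 : t' + 2 * u ∈ U) (h4 : t + 4 * u ∈ U) (h5 : t + 5 * u ∈ U)
    (ha : t + 2 * u - t' ∈ U) (hb : t + 3 * u - t' ∈ U) : False := by
  refine h (t' + 2 * u) (t + 2 * u - t') u h2 ha hu ?_ ?_ ?_
  · have e : t' + 2 * u + (t + 2 * u - t') = t + 4 * u := by ring
    rwa [e]
  · have e : t + 2 * u - t' + u = t + 3 * u - t' := by ring
    rwa [e]
  · have e : t' + 2 * u + (t + 2 * u - t') + u = t + 5 * u := by ring
    rwa [e]

end Structure
/-! ## §2 The second window `[6m, 7m]` -/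

section SecondWindow
/-- Three measurable subsets of `S` with empty triple intersection have total measure `≤ 2·vol S`. -/
theorem measure_three_le {A B C S : Set ℝ} (hB : MeasurableSet B) (hC : MeasurableSet C)
    (hAS : A ⊆ S) (hBS : B ⊆ S) (hCS : C ⊆ S) (h0 : ∀ t, t ∈ A → t ∈ B → t ∈ C → False) :
    volume A + volume B + volume C ≤ volume S + volume S := by
  have h1 : volume A + volume B = volume (A ∪ B) + volume (A ∩ B) :=
    (measure_union_add_inter A hB).symm
  have hdisj : Disjoint (A ∩ B) C :=
    Set.disjoint_left.2 fun t ht htC => h0 t ht.1 ht.2 htC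
  have h2 : volume (A ∩ B ∪ C) = volume (A ∩ B) + volume C := measure_union hdisj hC
  calc volume A + volume B + volume C
      = volume (A ∪ B) + (volume (A ∩ B) + volume C) := by rw [h1, add_assoc]
    _ = volume (A ∪ B) + volume (A ∩ B ∪ C) := by rw [h2]
    _ ≤ volume S + volume S :=
        add_le_add (measure_mono (union_subset hAS hBS))
          (measure_mono (union_subset (inter_subset_left.trans hAS) hCS))

/-- Five measurable subsets `B₁,…,B₅ ⊆ S` with `B₁ ∩ B₂ ∩ B₃ = ∅ = B₃ ∩ B₄ ∩ B₅` have total measure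
`≤ 3·vol S + vol(B₁ ∩ B₂ ∩ B₄ ∩ B₅)` (pointwise: a word on five positions with no `111` at `123`, `345`
has weight `≤ 3` unless it is `{1,2,4,5}`). -/
theorem measure_five_le {B₁ B₂ B₃ B₄ B₅ S : Set ℝ} (_h₁ : MeasurableSet B₁) (h₂ : MeasurableSet B₂)
    (h₃ : MeasurableSet B₃) (h₄ : MeasurableSet B₄) (h₅ : MeasurableSet B₅)
    (h₁S : B₁ ⊆ S) (h₂S : B₂ ⊆ S) (h₃S : B₃ ⊆ S) (h₄S : B₄ ⊆ S) (h₅S : B₅ ⊆ S)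
    (h123 : ∀ t, t ∈ B₁ → t ∈ B₂ → t ∈ B₃ → False) (h345 : ∀ t, t ∈ B₃ → t ∈ B₄ → t ∈ B₅ → False) :
    volume B₁ + volume B₂ + volume B₃ + volume B₄ + volume B₅ ≤
      volume S + volume S + volume S + volume (B₁ ∩ B₂ ∩ B₄ ∩ B₅) := by
  set D : Set ℝ := B₄ ∩ B₅ with hD
  set X : Set ℝ := B₁ ∩ B₂ with hX
  set Y : Set ℝ := B₃ ∪ D with hY
  have hDm : MeasurableSet D := h₄.inter h₅
  have hYm : MeasurableSet Y := h₃.union hDm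
  have e45 : volume B₄ + volume B₅ = volume (B₄ ∪ B₅) + volume D :=
    (measure_union_add_inter B₄ h₅).symm
  have e12 : volume B₁ + volume B₂ = volume (B₁ ∪ B₂) + volume X :=
    (measure_union_add_inter B₁ h₂).symm
  have hdisj : Disjoint B₃ D :=
    Set.disjoint_left.2 fun t ht htD => h345 t ht htD.1 htD.2
  have e3D : volume B₃ + volume D = volume Y := (measure_union hdisj hDm).symm
  have eXY : volume X + volume Y = volume (X ∪ Y) + volume (X ∩ Y) :=
    (measure_union_add_inter X hYm).symm
  have hXY : X ∩ Y ⊆ B₁ ∩ B₂ ∩ B₄ ∩ B₅ := by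
    rintro t ⟨⟨ht1, ht2⟩, ht3 | ⟨ht4, ht5⟩⟩
    · exact (h123 t ht1 ht2 ht3).elim
    · exact ⟨⟨⟨ht1, ht2⟩, ht4⟩, ht5⟩
  have hXYS : X ∪ Y ⊆ S := union_subset (inter_subset_left.trans h₁S)
    (union_subset h₃S (inter_subset_left.trans h₄S))
  calc volume B₁ + volume B₂ + volume B₃ + volume B₄ + volume B₅
      = (volume B₁ + volume B₂) + (volume B₄ + volume B₅) + volume B₃ := by ring
    _ = (volume (B₁ ∪ B₂) + volume X) + (volume (B₄ ∪ B₅) + volume D) + volume B₃ := by rw [e12, e45]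
    _ = volume (B₁ ∪ B₂) + volume (B₄ ∪ B₅) + (volume X + (volume B₃ + volume D)) := by ring
    _ = volume (B₁ ∪ B₂) + volume (B₄ ∪ B₅) + (volume (X ∪ Y) + volume (X ∩ Y)) := by rw [e3D, eXY]
    _ ≤ volume S + volume S + (volume S + volume (B₁ ∩ B₂ ∩ B₄ ∩ B₅)) := by
        gcongr
        · exact union_subset h₁S h₂S
        · exact union_subset h₄S h₅S
    _ = volume S + volume S + volume S + volume (B₁ ∩ B₂ ∩ B₄ ∩ B₅) := by ring

end SecondWindow
end Summit.Parity.GeneralizedHardyLittlewood.Theorems.PrimeGapInitialSegment
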